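import Mathlib
import Literature.Probability.LatticeModels.TemperleyLiebBaxterization
import Literature.Probability.Percolation.DiagonalColumnPatterns
import Literature.Probability.Percolation.DiagonalStripTransferInhomogeneous
import Literature.Probability.Percolation.DiagonalStripTransferReflection
import Literature.Probability.Percolation.DiagonalStripGenericRapidities
import Literature.Probability.Percolation.DiagonalStripGenericSwap
import HarnessLib

/-!
# The inversion endomorphisms `z_k → 1/z_k` of the rapidity field and the transfer matrix

Topic `Literature/Probability/Percolation`. The boundary reflections of Ikhlef–Ponsaing's qKZ system
(J. Stat. Phys. 149 (2012), arXiv:1202.5476, §3.4: `Ψ(1/z_1, …) = Ψ`, `Ψ(…, 1/z_L) = Ψ`) act on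
vectors of rational functions through the substitution `z_k ↦ z_k⁻¹`. This file constructs that
substitution as a ring endomorphism `genInv k` of `Frac K₀[X]`: on polynomials it is
`invSubst k` (`X_k ↦ z_k⁻¹`), which is injective by the reciprocal-polynomial identity
`invSubst k P · z_k^N = toRF (revPoly k N P)` (`revPoly` reverses the `k`-exponents against a bound
`N ≥ deg_k P`; `revPoly_ne_zero`), so it extends to the fraction field (`IsFractionRing.lift`).
Then `genInv_genZ/genW/genC` and, from `DiagonalStripTransferReflection.lean` and the
homomorphism-equivariance `map_ipTransferMatrixW`: **`genInv_ipTransferMatrixW_top`**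
(`genInv L (t) = t`) and **`genInv_ipTransferMatrixW_bottom`** (`genInv 1 (t)(Q → ·) = t(Q → ·)` for
inputs flagged at the wall).

## References

* Y. Ikhlef, A. K. Ponsaing, J. Stat. Phys. 149 (2012) 10–36, arXiv:1202.5476, Lemma 3.2, §3.4.
  [IkhlefPonsaing2012]
-/

namespace Literature.Probability.Percolation

open Literature.Probability.LatticeModels

variable {m : ℕ}

/-! ### The inversion endomorphisms `z_k → 1/z_k` of the rapidity field -/

section Inversion

open MvPolynomial

variable (K₀ : Type*) [Field K₀]

/-- The substitution `X_k ↦ z_k⁻¹`, `X_n ↦ z_n` (`n ≠ k`) on polynomials, valued in the rapidity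
field. [folklore] -/
noncomputable def invSubst (k : ℕ) : MvPolynomial ℕ K₀ →+* RapidityField K₀ :=
  eval₂Hom ((toRF K₀).comp C) (fun n => if n = k then (genZ K₀ k)⁻¹ else genZ K₀ n)

variable {K₀}

/-- The embedding itself is the trivial substitution. [folklore] -/
theorem toRF_eq_eval₂Hom : toRF K₀ = eval₂Hom ((toRF K₀).comp C) (genZ K₀) := by
  refine ringHom_ext (fun r => ?_) (fun i => ?_)
  · rw [eval₂Hom_C, RingHom.comp_apply]
  · rw [eval₂Hom_X']; rfl

/-- Reversing the `k`-exponent against a bound `N`. [folklore] -/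
noncomputable def revExp (k N : ℕ) (e : ℕ →₀ ℕ) : ℕ →₀ ℕ := e.update k (N - e k)

/-- The reversed exponent at `k`. [folklore] -/
theorem revExp_apply_self (k N : ℕ) (e : ℕ →₀ ℕ) : revExp k N e k = N - e k := by
  simp [revExp]

/-- The other exponents are unchanged. [folklore] -/
theorem revExp_apply_of_ne {k N n : ℕ} (e : ℕ →₀ ℕ) (h : n ≠ k) : revExp k N e n = e n := by
  simp [revExp, Finsupp.update_apply, h]

/-- Reversal is injective below the bound. [folklore] -/
theorem revExp_injOn (k N : ℕ) : Set.InjOn (revExp k N) {e : ℕ →₀ ℕ | e k ≤ N} := by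
  intro e he e' he' h
  ext n
  by_cases hn : n = k
  · subst hn
    have := congrArg (fun f => f n) h
    simp only [revExp_apply_self] at this
    simp only [Set.mem_setOf_eq] at he he'
    omega
  · have := congrArg (fun f => f n) h
    simpa [revExp_apply_of_ne _ hn] using this

/-- The support of a reversed exponent. [folklore] -/
theorem support_revExp_subset (k N : ℕ) (e : ℕ →₀ ℕ) : (revExp k N e).support ⊆ insert k e.support := by
  intro n hn
  rw [Finset.mem_insert]
  by_cases h : n = k
  · exact Or.inl h
  · right
    rw [Finsupp.mem_support_iff] at hn ⊢
    rwa [revExp_apply_of_ne _ h] at hn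

/-- The polynomial with the `k`-exponents reversed against the bound `N`. [folklore] -/
noncomputable def revPoly (k N : ℕ) (P : MvPolynomial ℕ K₀) : MvPolynomial ℕ K₀ :=
  ∑ e ∈ P.support, monomial (revExp k N e) (coeff e P)

/-- **The reciprocal-polynomial identity**: `invSubst k P · z_k^N = toRF (revPoly k N P)` when `N`
bounds the `k`-degree. [folklore] -/
theorem invSubst_mul_pow_eq (k N : ℕ) (P : MvPolynomial ℕ K₀) (hN : P.degreeOf k ≤ N) :
    invSubst K₀ k P * genZ K₀ k ^ N = toRF K₀ (revPoly k N P) := by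
  classical
  have hz : genZ K₀ k ≠ 0 := genZ_ne_zero k
  -- both sides are sums over the support of `P`
  conv_lhs => rw [P.as_sum, map_sum, Finset.sum_mul]
  rw [revPoly, map_sum]
  refine Finset.sum_congr rfl fun e he => ?_
  have hek : e k ≤ N := (monomial_le_degreeOf k he).trans hN
  rw [toRF_eq_eval₂Hom, invSubst, eval₂Hom_monomial, eval₂Hom_monomial, mul_assoc]
  congr 1
  -- compare the two monomials factor by factor over `insert k e.support`
  have hs : e.support ⊆ insert k e.support := Finset.subset_insert _ _
  rw [Finsupp.prod_of_support_subset e hs _ (fun i _ => pow_zero _),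
    Finsupp.prod_of_support_subset _ (support_revExp_subset k N e) _ (fun i _ => pow_zero _),
    ← Finset.mul_prod_erase _ _ (Finset.mem_insert_self k e.support),
    ← Finset.mul_prod_erase _ _ (Finset.mem_insert_self k e.support)]
  rw [if_pos rfl, revExp_apply_self, mul_right_comm]
  congr 1
  · rw [inv_pow, ← zpow_natCast, ← zpow_natCast, ← zpow_neg, ← zpow_add₀ hz, ← zpow_natCast]
    congr 1
    omega
  · refine Finset.prod_congr rfl fun n hn => ?_
    have hnk : n ≠ k := (Finset.mem_erase.1 hn).1
    rw [if_neg hnk, revExp_apply_of_ne _ hnk]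

/-- Reversing exponents does not kill a polynomial. [folklore] -/
theorem revPoly_ne_zero {k N : ℕ} {P : MvPolynomial ℕ K₀} (hP : P ≠ 0) (hN : P.degreeOf k ≤ N) :
    revPoly k N P ≠ 0 := by
  classical
  obtain ⟨e₀, he₀⟩ : P.support.Nonempty :=
    Finset.nonempty_of_ne_empty (fun h => hP (MvPolynomial.support_eq_empty.1 h))
  have hval : coeff (revExp k N e₀) (revPoly k N P) = coeff e₀ P := by
    rw [revPoly, coeff_sum]
    simp only [coeff_monomial]
    rw [Finset.sum_eq_single e₀]
    · rw [if_pos rfl]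
    · intro e he hne
      rw [if_neg]
      intro h
      exact hne (revExp_injOn k N ((monomial_le_degreeOf k he).trans hN) ((monomial_le_degreeOf k he₀).trans hN) h)
    · intro h; exact absurd he₀ h
  intro h0
  rw [h0, coeff_zero] at hval
  exact (mem_support_iff.1 he₀) hval.symm

/-- **The inversion substitution is injective.** [folklore] -/
theorem invSubst_injective (k : ℕ) : Function.Injective (invSubst K₀ k) := by
  refine (injective_iff_map_eq_zero _).2 fun P hP => ?_
  by_contra hne
  have h := invSubst_mul_pow_eq k (P.degreeOf k) P le_rfl
  rw [hP, zero_mul] at h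
  exact revPoly_ne_zero hne le_rfl (toRF_injective (by rw [← h, map_zero]))

variable (K₀)

/-- **The inversion endomorphism `z_k → 1/z_k` of the rapidity field.** [folklore] -/
noncomputable def genInv (k : ℕ) : RapidityField K₀ →+* RapidityField K₀ :=
  IsFractionRing.lift (invSubst_injective (K₀ := K₀) k)

variable {K₀}

/-- `genInv` on polynomials. [folklore] -/
theorem genInv_toRF (k : ℕ) (P : MvPolynomial ℕ K₀) : genInv K₀ k (toRF K₀ P) = invSubst K₀ k P :=
  IsFractionRing.lift_algebraMap _ P

/-- `genInv k` inverts `z_k` and fixes the other rapidities. [folklore] -/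
theorem genInv_genZ (k n : ℕ) : genInv K₀ k (genZ K₀ n) = Function.update (genZ K₀) k (genZ K₀ k)⁻¹ n := by
  rw [show genZ K₀ n = toRF K₀ (X n) from rfl, genInv_toRF, invSubst, eval₂Hom_X', Function.update_apply]

/-- `genInv k` fixes `w` (`k ≠ 0`). [folklore] -/
theorem genInv_genW {k : ℕ} (hk : k ≠ 0) : genInv K₀ k (genW K₀) = genW K₀ := by
  rw [show genW K₀ = toRF K₀ (X 0) from rfl, genInv_toRF, invSubst, eval₂Hom_X', if_neg (Ne.symm hk)]
  rfl

/-- `genInv k` fixes the constants. [folklore] -/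
theorem genInv_genC (k : ℕ) (q : K₀) : genInv K₀ k (genC K₀ q) = genC K₀ q := by
  rw [show genC K₀ q = toRF K₀ (C q) from rfl, genInv_toRF, invSubst, eval₂Hom_C, RingHom.comp_apply]

/-- **`genInv L (t(w; z⃗)) = t(w; z⃗)`**: the generic transfer matrix is invariant under `z_L → 1/z_L`.
[cite: IkhlefPonsaing2012, Lemma 3.2] -/
theorem genInv_ipTransferMatrixW_top (q : K₀) (Q Q' : ColPattern m) :
    genInv K₀ (2 * m + 1) (ipTransferMatrixW m (genC K₀ q) (genW K₀) (genZ K₀) Q Q') =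
      ipTransferMatrixW m (genC K₀ q) (genW K₀) (genZ K₀) Q Q' := by
  rw [map_ipTransferMatrixW, genInv_genC, genInv_genW (by omega)]
  rw [show (genInv K₀ (2 * m + 1) : RapidityField K₀ → RapidityField K₀) ∘ genZ K₀ =
      Function.update (genZ K₀) (2 * m + 1) (genZ K₀ (2 * m + 1))⁻¹ from funext (genInv_genZ _),
    ipTransferMatrixW_reflect_top]

/-- **`genInv 1 (t(w; z⃗))(Q → ·) = t(w; z⃗)(Q → ·)`** for inputs flagged at the wall site.
[cite: IkhlefPonsaing2012, Lemma 3.2] -/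
theorem genInv_ipTransferMatrixW_bottom (q : K₀) {Q : ColPattern m} (hQ0 : Q.2 0 = true) (Q' : ColPattern m) :
    genInv K₀ 1 (ipTransferMatrixW m (genC K₀ q) (genW K₀) (genZ K₀) Q Q') =
      ipTransferMatrixW m (genC K₀ q) (genW K₀) (genZ K₀) Q Q' := by
  rw [map_ipTransferMatrixW, genInv_genC, genInv_genW one_ne_zero]
  rw [show (genInv K₀ 1 : RapidityField K₀ → RapidityField K₀) ∘ genZ K₀ =
      Function.update (genZ K₀) 1 (genZ K₀ 1)⁻¹ from funext (genInv_genZ _),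
    ipTransferMatrixW_reflect_bottom _ _ _ hQ0]

end Inversion

end Literature.Probability.Percolation
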